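import Mathlib
import HarnessLib
import Summits.ResolutionOfSingularities.ResolutionOfSingularities.Theorems.WildQuotientsWildQuotientResolutionS1aA1Move3Ring
import Summits.ResolutionOfSingularities.ResolutionOfSingularities.Theorems.WildQuotientsWildQuotientResolutionS1aA1Move3Cover
import Summits.ResolutionOfSingularities.ResolutionOfSingularities.Theorems.WildQuotientsWildQuotientResolutionS1aNodeCentre
import Summits.ResolutionOfSingularities.ResolutionOfSingularities.Theorems.WildQuotientsWildQuotientResolutionS1aModelNodeAtlas
import Summits.ResolutionOfSingularities.ResolutionOfSingularities.Theorems.WildQuotientsWildQuotientResolutionS1aKillGlue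

/-!
# S1a — INSTANCE I-2 (a1): MOVE 3 OF MT-a1″ = THE KILL, over an ABSTRACT model of the node of the residual chart `[X₀]₂`

[OURS · L1 W4.5c · lead-1 g13; plan-1 CHAIN v10.40 §4 ASSIGNMENT (ii)/(iii) «one theorem per move; A1Move3 … one-row kills per X-CERT v1 §3»,
R-F15c (I-2 := MT-a1″: move 3 on `[X₀′]₂` = centre `(s₂:1, Y₂:1, s:2; δ1)` = KILL), X-CERT v1 §3 a1 move 3 (three producer charts, ALL KILLED)] — NOT
statements of the manuscript; counted 0; AI-level work, weaker than expert review. Crux stmt-ResolutionOfSingularities-17941 `CyclicQuotientFourfolds`,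
line `s1a-logminvertex` v13 (`stub_reachLowerInFX`).

* ★★★ `GameFrame.GModel.a1_move3` — `M₂` a separated model, `W₂` a stable affine chart with node `DW₂` modelled by `Φ : DW₂.B ≃+* Q` (`τ = Φ⁻¹σΦ` with the
  move-3 rows of `…S1aA1Move3Ring`: `τX₁ = X₁ + s₂²Y₀s`, `τY₂ = Y₂ + s²Y₀s₂`, `τx₃ = x₃ + sX₁(s₂Y₂)`; `s₂, Y₀, s, η⁻¹, κ` and `Gfix` fixed; `X₁, Y₀, η⁻¹, κ`
  units; K1′ for `(s₂, Y₂, s)` and the node-grading degrees as HYPOTHESES), an atlas `𝔄₂` with `F_𝔄₂ ⊆ W₂`, and a cover `M₂.V = W₂ ∪ ⋃ Uᵢ` with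
  separating sections `uᵢ ∈ Γ(M₂, W₂)` (units on `W₂ ∩ Uᵢ`, values in a positive filtration level): then `(s₂:1, Y₂:1, s:2)` is an ADMISSIBLE move `𝒦₃`
  on `M₂` and EVERY realisation `π₃ : M₃ → M₂` carries a node atlas `𝔄₃` with EMPTY formal locus — all three producer charts are killed by the residual
  sections `c_j·c_j⁻¹ = 1` (`c_j ∈ 𝔞₃`, ✓`a1m3_cover_mem_ideal` + ✓`a1m3_residual_mem`). This is the leaf level `KillsIn 0` of the a1 kill tree.
-/

set_option linter.dupNamespace false

noncomputable section

open CategoryTheory Limits AlgebraicGeometry TopologicalSpace Topology Opposite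
open Literature.AlgebraicGeometry.Resolution Literature.AlgebraicGeometry.RelativeSpec
open scoped LaurentPolynomial
open Summit.ResolutionOfSingularities.ResolutionOfSingularities.Theorems.WildQuotientResolution.S1
open Summit.ResolutionOfSingularities.ResolutionOfSingularities.Theorems.WildQuotientResolution.S1.NodeAtlas
open Summit.ResolutionOfSingularities.ResolutionOfSingularities.Theorems.WildQuotientResolution.S1.CoarseChart
open Summit.ResolutionOfSingularities.ResolutionOfSingularities.Theorems.WildQuotientResolution.S1.ProducerStep
open Summit.ResolutionOfSingularities.ResolutionOfSingularities.Theorems.WildQuotientResolution.S1.NpFrame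
open Summit.ResolutionOfSingularities.ResolutionOfSingularities.Theorems.WildQuotientResolution.S1.GoodCharts
open Summit.ResolutionOfSingularities.ResolutionOfSingularities.Theorems.WildQuotientResolution.S1.BlowupCharts
open Summit.ResolutionOfSingularities.ResolutionOfSingularities.Theorems.WildQuotientResolution.S1.KillableTransport
open Summit.ResolutionOfSingularities.ResolutionOfSingularities.Theorems.WildQuotientResolution.S1.KillCert
open Summit.ResolutionOfSingularities.ResolutionOfSingularities.Theorems.WildQuotientResolution.S1.ReesBigrading
open Summit.ResolutionOfSingularities.ResolutionOfSingularities.Theorems.WildQuotientResolution.S1.NodeTransport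
open Summit.ResolutionOfSingularities.ResolutionOfSingularities.Theorems.WildQuotientResolution.BlowupExit
open Summit.ResolutionOfSingularities.ResolutionOfSingularities.Theorems.WildQuotientResolution.S1.KillGlue

namespace Summit.ResolutionOfSingularities.ResolutionOfSingularities.Theorems.WildQuotientResolution.S1.GameFrame.GModel

variable {p : ℕ} {X' X₁ : Scheme.{0}} {q : X' ⟶ X₁} {G : Type} [Group G] {ρ : G →* Aut X'} {g₀ : G}

set_option maxHeartbeats 4000000 in
/-- ★★★ **MOVE 3 OF MT-a1″ = THE KILL (abstract model of the node of `[X₀]₂`): an admissible move every realisation of which carries a node atlas with EMPTY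
formal locus.** See the module docstring. [OURS · L1 W4.5c · R-F15c I-2, move 3 of 3; NOT a statement of the manuscript] -/
theorem a1_move3 [Finite G] [NeZero p] (hp : p.Prime) (hG : ∀ g : G, g ∈ Subgroup.zpowers g₀)
    (M₂ : GModel p q G ρ g₀) [M₂.V.IsSeparated] (W₂ : M₂.act.StableAffineOpens) (DW₂ : NodeData p M₂.act g₀ W₂)
    {Q : Type} [CommRing Q] [CharP Q p] (Φ : letI := DW₂.instCommRing; DW₂.B ≃+* Q) (τ : Q ≃+* Q)
    (hτ : letI := DW₂.instCommRing; ∀ x : Q, τ x = Φ (DW₂.σ (Φ.symm x)))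
    -- generators of the model and the rows of `τ`
    (s₂ Y₀ X₁ Y₂ x₃ s ηinv κ : Q) (Gfix : Set Q)
    (hs₂ : τ s₂ = s₂) (hY₀ : τ Y₀ = Y₀) (hX₁ : τ X₁ = X₁ + s₂ ^ 2 * Y₀ * s) (hY₂ : τ Y₂ = Y₂ + s ^ 2 * Y₀ * s₂)
    (hx₃ : τ x₃ = x₃ + s * X₁ * (s₂ * Y₂)) (hs : τ s = s) (hηinv : τ ηinv = ηinv) (hκ : τ κ = κ)
    (hfix : ∀ g ∈ Gfix, τ g = g) (hgen : Subring.closure (({s₂, Y₀, X₁, Y₂, x₃, s} : Set Q) ∪ Gfix) = ⊤)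
    (hX₁u : IsUnit X₁) (hY₀u : IsUnit Y₀) (hηu : IsUnit ηinv) (hκu : IsUnit κ)
    -- degrees of the generators in the transported grading
    (θ₁ θ₂ : Π j : Fin DW₂.m, ZMod (DW₂.r j)) (d d₂ : ℕ) (hd : 0 < d) (hd₂ : 0 < d₂)
    (hs₂d : letI := DW₂.instCommRing; letI := DW₂.instGradedRing; s₂ ∈ mapGrading DW₂.𝒜 Φ (-θ₂))
    (hY₀d : letI := DW₂.instCommRing; letI := DW₂.instGradedRing; Y₀ ∈ mapGrading DW₂.𝒜 Φ (2 • θ₂ + 2 • θ₁))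
    (hY₂d : letI := DW₂.instCommRing; letI := DW₂.instGradedRing; Y₂ ∈ mapGrading DW₂.𝒜 Φ θ₂)
    (hsd : letI := DW₂.instCommRing; letI := DW₂.instGradedRing; s ∈ mapGrading DW₂.𝒜 Φ (-θ₁))
    (hηinvd : letI := DW₂.instCommRing; letI := DW₂.instGradedRing; ηinv ∈ mapGrading DW₂.𝒜 Φ (-((d * (2 * p)) • θ₁)))
    (hκd : letI := DW₂.instCommRing; letI := DW₂.instGradedRing; κ ∈ mapGrading DW₂.𝒜 Φ (-((d₂ * (d * (2 * p))) • θ₂)))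
    -- K1′ for the centre `(s₂, Y₂, s)`
    (hK1 : RingTheory.Sequence.IsRegular Q (List.ofFn (![s₂, Y₂, s] : Fin 3 → Q)))
    (hK1' : IsRegularRing (Q ⧸ Ideal.span (Set.range (![s₂, Y₂, s] : Fin 3 → Q))))
    -- the closedness datum on `M₂`: a cover and separating sections
    {ι : Type} (U : ι → M₂.V.Opens) (hcov : ∀ x : M₂.V, x ∈ W₂.1 ∨ ∃ i, x ∈ U i) (u : ι → Γ(M₂.V, W₂.1)) (nu : ι → ℕ) (hnu : ∀ i, 0 < nu i)
    (hu : letI := DW₂.instCommRing; letI := DW₂.instGradedRing; ∀ i,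
      Φ ((DW₂.e (u i) : ↥(DW₂.𝒜 0)) : DW₂.B) ∈ (weightedFiltration (![s₂, Y₂, s] : Fin 3 → Q) ![1, 1, 2]).ideal (nu i))
    (huU : ∀ i, ∀ v ∈ W₂.1, v ∈ U i → v ∈ M₂.V.basicOpen (u i))
    (𝔄₂ : NodeAtlasData p M₂.act g₀) (hF₂ : 𝔄₂.fLocus ⊆ (W₂.1 : Set M₂.V)) :
    ∃ (𝒦₃ : ReesFiltration M₂.V) (d₃ : ℕ), 0 < d₃ ∧ IsAdmissibleCentre p M₂.act g₀ 𝒦₃ d₃ ∧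
      ∀ (M₃ : GModel p q G ρ g₀) (π₃ : M₃.V ⟶ M₂.V), IsBlowup π₃ (𝒦₃.ideal d₃) → M₃.r = π₃ ≫ M₂.r →
        (∀ g : G, (M₃.act.aut g).hom ≫ π₃ = π₃ ≫ (M₂.act.aut g).hom) →
        ∃ 𝔄₃ : NodeAtlasData p M₃.act g₀, 𝔄₃.fLocus = ∅ := by
  classical
  letI := DW₂.instCommRing
  letI := DW₂.instGradedRing
  letI := mapGradedRing DW₂.𝒜 Φ
  have hp1 : p ≠ 1 := hp.one_lt.ne'
  have hdp : 0 < d * p := Nat.mul_pos hd hp.pos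
  have hk₃ : 0 < 2 * (d₂ * (d * (2 * p))) := Nat.mul_pos two_pos (Nat.mul_pos hd₂ (Nat.mul_pos hd (Nat.mul_pos two_pos hp.pos)))
  have hw : ∀ i, 0 < (![1, 1, 2] : Fin 3 → ℕ) i := fun i => by fin_cases i <;> norm_num
  -- the transported node, read through `τ`
  have hτeq : (conj Φ DW₂.σ : Q ≃+* Q) = τ := RingEquiv.ext fun x => (hτ x).symm
  have htameτ : IsTameNode p Q (mapGrading DW₂.𝒜 Φ) τ := hτeq ▸ isTameNode_map DW₂.𝒜 Φ p DW₂.σ DW₂.tame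
  have hσp : ∀ x : Q, (⇑τ)^[p] x = x := htameτ.2.2.2.2.2
  have hσL : ∀ t' : Γ(M₂.V, W₂.1), (((DW₂.e.trans (zeroRingEquiv DW₂.𝒜 Φ)) ((M₂.act.aut g₀⁻¹).hom.appLE W₂.1 W₂.1 (W₂.2.1 g₀⁻¹).ge t') :
      ↥(mapGrading DW₂.𝒜 Φ 0)) : Q) = τ (((DW₂.e.trans (zeroRingEquiv DW₂.𝒜 Φ)) t' : ↥(mapGrading DW₂.𝒜 Φ 0)) : Q) := fun t' => by
    change Φ ((DW₂.e (actO M₂.act W₂ g₀ t') : ↥(DW₂.𝒜 0)) : DW₂.B) = τ (Φ ((DW₂.e t' : ↥(DW₂.𝒜 0)) : DW₂.B))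
    rw [DW₂.intertwine t', hτ, Φ.symm_apply_apply]
  have hf₃ := A1.a1m3_hf s₂ Y₂ s DW₂.r (mapGrading DW₂.𝒜 Φ) θ₁ θ₂ hs₂d hY₂d hsd
  have hσJ₃ := A1.a1m3_map_le τ s₂ Y₀ X₁ Y₂ x₃ s Gfix hs₂ hY₀ hX₁ hY₂ hx₃ hs hfix hgen
  have hσJc : ∀ n : ℕ, ((weightedFiltration (![s₂, Y₂, s] : Fin 3 → Q) ![1, 1, 2]).ideal n).map (conj Φ DW₂.σ : Q →+* Q) ≤
      (weightedFiltration (![s₂, Y₂, s] : Fin 3 → Q) ![1, 1, 2]).ideal n := by rw [hτeq]; exact hσJ₃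
  -- closedness of the traces from the separating sections
  have hcl₃ : ∀ n : ℕ, 0 < n →
      closure (M₂.V.zeroLocus (U := W₂.1)
          ((((traceFiltration (mapGrading DW₂.𝒜 Φ) (![s₂, Y₂, s] : Fin 3 → Q) ![1, 1, 2]).ideal n).comap
              ((DW₂.e.trans (zeroRingEquiv DW₂.𝒜 Φ) : Γ(M₂.V, W₂.1) ≃+* ↥(mapGrading DW₂.𝒜 Φ 0)) : Γ(M₂.V, W₂.1) →+* ↥(mapGrading DW₂.𝒜 Φ 0)) :
            Ideal Γ(M₂.V, W₂.1)) : Set Γ(M₂.V, W₂.1)) ∩ (W₂.1 : Set M₂.V)) ⊆ (W₂.1 : Set M₂.V) := by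
    intro n hn
    refine closure_zeroLocus_inter_subset_of_cover W₂.1 U hcov _ u (fun i => ⟨n, hn, ?_⟩) huU
    change (DW₂.e.trans (zeroRingEquiv DW₂.𝒜 Φ)) (u i ^ n) ∈ (traceFiltration (mapGrading DW₂.𝒜 Φ) (![s₂, Y₂, s] : Fin 3 → Q) ![1, 1, 2]).ideal n
    rw [mem_traceFiltration_iff, map_pow, SetLike.GradeZero.coe_pow]
    change (Φ ((DW₂.e (u i) : ↥(DW₂.𝒜 0)) : DW₂.B)) ^ n ∈ _
    have h := Ideal.pow_mem_pow (hu i) n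
    have hle := Veronese.idealFiltration_pow_le (weightedFiltration (![s₂, Y₂, s] : Fin 3 → Q) ![1, 1, 2]) (nu i) n
    exact (weightedFiltration (![s₂, Y₂, s] : Fin 3 → Q) ![1, 1, 2]).antitone (Nat.le_mul_of_pos_left n (hnu i)) (hle h)
  -- ### the centre of move 3
  obtain ⟨𝒦₃, d₃, hd₃, hadm₃, -, hG𝒦₃, h𝒦₃O, hver₃, hsupp₃⟩ := exists_isAdmissibleCentre_of_node hG M₂ W₂ DW₂ Φ (by norm_num : 0 < 3)
    (![s₂, Y₂, s] : Fin 3 → Q) (![-θ₂, θ₂, -θ₁]) ![1, 1, 2] hw hf₃ hK1 hK1' hσJc hcl₃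
  refine ⟨𝒦₃, d₃, hd₃, hadm₃, fun M₃ π₃ hbl₃ hr₃ hcomm₃ => ?_⟩
  -- ### the realisation `M₃`: cover, (H1), residual, atlas
  obtain ⟨hdeg0, hdeg1, hdeg2⟩ := A1.a1m3_y_deg s₂ Y₀ Y₂ s ηinv κ (p := p) d d₂ d₃ DW₂.r (mapGrading DW₂.𝒜 Φ) θ₁ θ₂ hs₂d hY₀d hY₂d hsd hηinvd hκd
  obtain ⟨y', hy'0, hy'1, hy'2⟩ : ∃ y' : Fin 3 → ↥(mapGrading DW₂.𝒜 Φ 0), y' 0 = ⟨_, hdeg0⟩ ∧ y' 1 = ⟨_, hdeg1⟩ ∧ y' 2 = ⟨_, hdeg2⟩ :=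
    ⟨![⟨_, hdeg0⟩, ⟨_, hdeg1⟩, ⟨_, hdeg2⟩], rfl, rfl, rfl⟩
  have hy'v0 : ((y' 0 : ↥(mapGrading DW₂.𝒜 Φ 0)) : Q) = (s₂ ^ (2 * (d * p)) * (Y₀ ^ (d * p) * ηinv)) ^ (2 * d₂ * d₃) := congrArg Subtype.val hy'0
  have hy'v1 : ((y' 1 : ↥(mapGrading DW₂.𝒜 Φ 0)) : Q) = ((∏ i : ZMod p, (Y₂ + (i.val : Q) * (s ^ 2 * Y₀ * s₂))) ^ (2 * d * d₂) * κ) ^ (2 * d₃) :=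
    congrArg Subtype.val hy'1
  have hy'v2 : ((y' 2 : ↥(mapGrading DW₂.𝒜 Φ 0)) : Q) = (s ^ (d₂ * (d * (2 * p))) * (Y₀ ^ (d₂ * (d * p)) * κ)) ^ d₃ := congrArg Subtype.val hy'2
  obtain ⟨hmem0, hmem1, hmem2⟩ := A1.a1m3_y_mem s₂ Y₀ Y₂ s ηinv κ (p := p) d d₂ d₃
  have hy' : ∀ j, y' j ∈ (traceFiltration (mapGrading DW₂.𝒜 Φ) (![s₂, Y₂, s] : Fin 3 → Q) ![1, 1, 2]).ideal (d₃ * (2 * (d₂ * (d * (2 * p))))) := by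
    intro j
    rw [mem_traceFiltration_iff]
    fin_cases j
    · exact (congrArg (fun x : Q => x ∈ (weightedFiltration (![s₂, Y₂, s] : Fin 3 → Q) ![1, 1, 2]).ideal (d₃ * (2 * (d₂ * (d * (2 * p)))))) hy'v0).mpr hmem0
    · exact (congrArg (fun x : Q => x ∈ (weightedFiltration (![s₂, Y₂, s] : Fin 3 → Q) ![1, 1, 2]).ideal (d₃ * (2 * (d₂ * (d * (2 * p)))))) hy'v1).mpr hmem1
    · exact (congrArg (fun x : Q => x ∈ (weightedFiltration (![s₂, Y₂, s] : Fin 3 → Q) ![1, 1, 2]).ideal (d₃ * (2 * (d₂ * (d * (2 * p)))))) hy'v2).mpr hmem2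
  obtain ⟨hfix0, hfix1, hfix2⟩ := A1.a1m3_y_fixed τ s₂ Y₀ Y₂ s ηinv κ hs₂ hY₀ hY₂ hs hηinv hκ (p := p) d d₂ d₃ hp1
  have hσy' : ∀ j, τ (y' j : Q) = y' j := by
    intro j
    fin_cases j
    · exact (congrArg τ hy'v0).trans (hfix0.trans hy'v0.symm)
    · exact (congrArg τ hy'v1).trans (hfix1.trans hy'v1.symm)
    · exact (congrArg τ hy'v2).trans (hfix2.trans hy'v2.symm)
  have hc0' : ((coverElement (mapGrading DW₂.𝒜 Φ) (![s₂, Y₂, s] : Fin 3 → Q) ![1, 1, 2] (d₃ * (2 * (d₂ * (d * (2 * p))))) (y' 0) (hy' 0) :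
      ↥(cobordantAlgebra (![s₂, Y₂, s] : Fin 3 → Q) ![1, 1, 2])) : Q[T;T⁻¹]) =
      LaurentPolynomial.C ((s₂ ^ (2 * (d * p)) * (Y₀ ^ (d * p) * ηinv)) ^ (2 * d₂ * d₃)) * LaurentPolynomial.T (((d₃ * (2 * (d₂ * (d * (2 * p))))) : ℕ) : ℤ) :=
    (coe_coverElement (mapGrading DW₂.𝒜 Φ) (![s₂, Y₂, s] : Fin 3 → Q) ![1, 1, 2] (d₃ * (2 * (d₂ * (d * (2 * p))))) (y' 0) (hy' 0)).trans
      (congrArg (fun x : Q => LaurentPolynomial.C x * LaurentPolynomial.T (((d₃ * (2 * (d₂ * (d * (2 * p))))) : ℕ) : ℤ)) hy'v0)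
  have hc1' : ((coverElement (mapGrading DW₂.𝒜 Φ) (![s₂, Y₂, s] : Fin 3 → Q) ![1, 1, 2] (d₃ * (2 * (d₂ * (d * (2 * p))))) (y' 1) (hy' 1) :
      ↥(cobordantAlgebra (![s₂, Y₂, s] : Fin 3 → Q) ![1, 1, 2])) : Q[T;T⁻¹]) =
      LaurentPolynomial.C (((∏ i : ZMod p, (Y₂ + (i.val : Q) * (s ^ 2 * Y₀ * s₂))) ^ (2 * d * d₂) * κ) ^ (2 * d₃)) *
        LaurentPolynomial.T (((d₃ * (2 * (d₂ * (d * (2 * p))))) : ℕ) : ℤ) :=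
    (coe_coverElement (mapGrading DW₂.𝒜 Φ) (![s₂, Y₂, s] : Fin 3 → Q) ![1, 1, 2] (d₃ * (2 * (d₂ * (d * (2 * p))))) (y' 1) (hy' 1)).trans
      (congrArg (fun x : Q => LaurentPolynomial.C x * LaurentPolynomial.T (((d₃ * (2 * (d₂ * (d * (2 * p))))) : ℕ) : ℤ)) hy'v1)
  have hc2' : ((coverElement (mapGrading DW₂.𝒜 Φ) (![s₂, Y₂, s] : Fin 3 → Q) ![1, 1, 2] (d₃ * (2 * (d₂ * (d * (2 * p))))) (y' 2) (hy' 2) :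
      ↥(cobordantAlgebra (![s₂, Y₂, s] : Fin 3 → Q) ![1, 1, 2])) : Q[T;T⁻¹]) =
      LaurentPolynomial.C ((s ^ (d₂ * (d * (2 * p))) * (Y₀ ^ (d₂ * (d * p)) * κ)) ^ d₃) * LaurentPolynomial.T (((d₃ * (2 * (d₂ * (d * (2 * p))))) : ℕ) : ℤ) :=
    (coe_coverElement (mapGrading DW₂.𝒜 Φ) (![s₂, Y₂, s] : Fin 3 → Q) ![1, 1, 2] (d₃ * (2 * (d₂ * (d * (2 * p))))) (y' 2) (hy' 2)).trans
      (congrArg (fun x : Q => LaurentPolynomial.C x * LaurentPolynomial.T (((d₃ * (2 * (d₂ * (d * (2 * p))))) : ℕ) : ℤ)) hy'v2)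
  have hrad' : ∀ i : Fin 3, cobordantAlgebra.u' (![s₂, Y₂, s] : Fin 3 → Q) ![1, 1, 2] i ∈
      (Ideal.span (Set.range fun j => coverElement (mapGrading DW₂.𝒜 Φ) (![s₂, Y₂, s] : Fin 3 → Q) ![1, 1, 2] (d₃ * (2 * (d₂ * (d * (2 * p))))) (y' j) (hy' j))).radical := by
    intro i
    have h := A1.a1m3_hrad s₂ Y₀ Y₂ s ηinv κ (p := p) d d₂ d₃ hY₀u hηu hκu _ _ _ hc0' hc1' hc2' i
    refine Ideal.radical_mono (Ideal.span_mono ?_) h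
    refine Set.insert_subset_iff.mpr ⟨⟨0, rfl⟩, Set.insert_subset_iff.mpr ⟨⟨1, rfl⟩, Set.singleton_subset_iff.mpr ⟨2, rfl⟩⟩⟩
  -- (H1) and «every cover element lies in the residual ideal»
  have hH1 := A1.a1m3_augmentationIdeal_sigmaR_le τ s₂ Y₀ X₁ Y₂ x₃ s Gfix hs₂ hY₀ hX₁ hY₂ hx₃ hs hfix hgen hp.pos hσp
  obtain ⟨hr0, hr1, hr2⟩ := A1.a1m3_residual_mem τ s₂ Y₀ X₁ Y₂ x₃ s Gfix hs₂ hY₀ hX₁ hY₂ hx₃ hs hfix hgen hp.pos hσp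
  obtain ⟨hcm0, hcm1, hcm2⟩ := A1.a1m3_cover_mem_ideal s₂ Y₀ X₁ Y₂ s ηinv κ (p := p) d d₂ d₃ hX₁u hdp hd₂ hd₃ _ hr0 hr1 hr2 _ _ _ hc0' hc1' hc2'
  have hcm : ∀ j, coverElement (mapGrading DW₂.𝒜 Φ) (![s₂, Y₂, s] : Fin 3 → Q) ![1, 1, 2] (d₃ * (2 * (d₂ * (d * (2 * p))))) (y' j) (hy' j) ∈
      (augmentationIdeal (sigmaR τ (![s₂, Y₂, s] : Fin 3 → Q) ![1, 1, 2] hσJ₃ hp.pos hσp)).colon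
        (Ideal.span {algebraMap Q ↥(cobordantAlgebra (![s₂, Y₂, s] : Fin 3 → Q) ![1, 1, 2]) (s * s₂) * cobordantAlgebra.s (![s₂, Y₂, s] : Fin 3 → Q) ![1, 1, 2]}) := by
    intro j
    fin_cases j
    · exact hcm0
    · exact hcm1
    · exact hcm2
  -- the atlas of move 3
  obtain ⟨OW₃, hOW₃aff, hOW₃eq, E₃, htame₃, hE₃, hpin₃, 𝔄₃, hF₃⟩ := exists_moveAtlas_of_node hp.pos hG M₂ M₃ 𝔄₂ W₂ DW₂.affine
    DW₂.r (mapGrading DW₂.𝒜 Φ) (![s₂, Y₂, s] : Fin 3 → Q) ![1, 1, 2] hf₃ τ (DW₂.e.trans (zeroRingEquiv DW₂.𝒜 Φ)) htameτ hσp hσL hw hK1 hK1' hσJ₃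
    𝒦₃ d₃ hG𝒦₃ h𝒦₃O hver₃ hsupp₃ π₃ hbl₃ hr₃ hcomm₃ hk₃ y' hy' hσy' hrad'
    (algebraMap Q ↥(cobordantAlgebra (![s₂, Y₂, s] : Fin 3 → Q) ![1, 1, 2]) (s * s₂) * cobordantAlgebra.s (![s₂, Y₂, s] : Fin 3 → Q) ![1, 1, 2]) hH1 (fun _ => 1)
    (fun j => ![algebraMap _ (ChartRing (mapGrading DW₂.𝒜 Φ) (![s₂, Y₂, s] : Fin 3 → Q) ![1, 1, 2] (d₃ * (2 * (d₂ * (d * (2 * p))))) (y' j) (hy' j))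
        (coverElement (mapGrading DW₂.𝒜 Φ) (![s₂, Y₂, s] : Fin 3 → Q) ![1, 1, 2] (d₃ * (2 * (d₂ * (d * (2 * p))))) (y' j) (hy' j)) *
      IsLocalization.Away.invSelf (coverElement (mapGrading DW₂.𝒜 Φ) (![s₂, Y₂, s] : Fin 3 → Q) ![1, 1, 2] (d₃ * (2 * (d₂ * (d * (2 * p))))) (y' j) (hy' j))])
    (fun j l => by
      fin_cases l
      exact residualSection_mem_chartNodeGrading_zero DW₂.r (mapGrading DW₂.𝒜 Φ) (![s₂, Y₂, s] : Fin 3 → Q) ![1, 1, 2] hf₃ (y' j) (hy' j)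
        (coverElement_mem_reesPiece (mapGrading DW₂.𝒜 Φ) (![s₂, Y₂, s] : Fin 3 → Q) ![1, 1, 2] (d₃ * (2 * (d₂ * (d * (2 * p))))) (y' j) (hy' j)))
    (fun j l => by
      fin_cases l
      exact residualSection_mem_map DW₂.r (mapGrading DW₂.𝒜 Φ) (![s₂, Y₂, s] : Fin 3 → Q) ![1, 1, 2] (y' j) (hy' j) (hcm j))
  -- every producer chart is killed: its residual section is `1`
  have hzW : ∀ j, ∀ v ∈ (OW₃ j).1, v ∈ M₃.V.basicOpen
      (letI := chartNodeGradedRing DW₂.r (mapGrading DW₂.𝒜 Φ) (![s₂, Y₂, s] : Fin 3 → Q) ![1, 1, 2] hf₃ (d₃ * (2 * (d₂ * (d * (2 * p))))) (y' j) (hy' j);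
        (E₃ j).symm ⟨_, residualSection_mem_chartNodeGrading_zero DW₂.r (mapGrading DW₂.𝒜 Φ) (![s₂, Y₂, s] : Fin 3 → Q) ![1, 1, 2] hf₃ (y' j) (hy' j)
          (coverElement_mem_reesPiece (mapGrading DW₂.𝒜 Φ) (![s₂, Y₂, s] : Fin 3 → Q) ![1, 1, 2] (d₃ * (2 * (d₂ * (d * (2 * p))))) (y' j) (hy' j))⟩) := by
    intro j v hv
    letI := chartNodeGradedRing DW₂.r (mapGrading DW₂.𝒜 Φ) (![s₂, Y₂, s] : Fin 3 → Q) ![1, 1, 2] hf₃ (d₃ * (2 * (d₂ * (d * (2 * p))))) (y' j) (hy' j)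
    have h1 : (⟨_, residualSection_mem_chartNodeGrading_zero DW₂.r (mapGrading DW₂.𝒜 Φ) (![s₂, Y₂, s] : Fin 3 → Q) ![1, 1, 2] hf₃ (y' j) (hy' j)
          (coverElement_mem_reesPiece (mapGrading DW₂.𝒜 Φ) (![s₂, Y₂, s] : Fin 3 → Q) ![1, 1, 2] (d₃ * (2 * (d₂ * (d * (2 * p))))) (y' j) (hy' j))⟩ :
        ↥((chartNodeGrading DW₂.r (mapGrading DW₂.𝒜 Φ) (![s₂, Y₂, s] : Fin 3 → Q) ![1, 1, 2] hf₃ (d₃ * (2 * (d₂ * (d * (2 * p))))) (y' j) (hy' j)) 0)) = 1 :=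
      Subtype.ext (IsLocalization.Away.mul_invSelf _)
    rw [h1, map_one, Scheme.basicOpen_of_isUnit _ isUnit_one]
    exact hv
  refine ⟨𝔄₃, Set.eq_empty_iff_forall_notMem.mpr fun v hv => ?_⟩
  rcases hF₃ hv with hold | hnew
  · exact hold.2 (hF₂ hold.1)
  · obtain ⟨j, hvW, hvR⟩ := Set.mem_iUnion.mp hnew
    exact hvR 0 (hzW j v hvW)

end Summit.ResolutionOfSingularities.ResolutionOfSingularities.Theorems.WildQuotientResolution.S1.GameFrame.GModel

end
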